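import Summits.QuantumAdvantage.QuantumAdvantage.Theorems.SosSandwichTransferPBHashedMean
import Literature.Computability.QuantumComplexity.QueryMagnitudePolynomial
import HarnessLib

/-!
# Crux `TransferPB` (stmt-QuantumAdvantage-15238, route SosSandwich), line `birth` — the SINGLE and BLOCK node quantities over the explicit hashed completion

Sequel of `Theorems/SosSandwichTransferPBHashedMean.lean` (MEAN instances). The SINGLE / BLOCK instances of the
node-test problem `nodeProblem F r c k` (`Theorems/SosSandwichTransferPBMachineDefs.lean`) compare the averaged BBBV
magnitude `m_s(ρ) = E_y[4T · W_{σ(s)}(oracleOf (y ◁ ρ))]` (`bbbvMag`) and the block sums `M_u(ρ) = Σ_{u ⊑ σ(s)} m_s(ρ)`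
(`blockMag`) with the threshold `w`; again `y` ranges over the `2^M` completions of the relevant bits. The total
query magnitude `W_{σ(s)}(A)` is a real polynomial of degree `≤ 2T` in the oracle bits
(`Literature/…/QueryMagnitudePolynomial.lean`, Beals et al. Lemma 4.1), so Zhandry's averaging identity
(`IsKWiseIndepFamily.keyAvg_evalBool_eq_boolAvg`) replaces `y` by the explicit `k`-wise independent family
`stdFamily k m` (`Literature/…/ExplicitKWiseHashFamily.lean`, evaluated in `P`) EXACTLY:

* `oraclePt_oracleOf` — the `0/1` point of the oracle with prescribed relevant bits `b` is `b` read through the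
  enumeration `bitEquiv`;
* `exists_bbbvPoly` — `m_s`'s integrand `y ↦ 4T · W_{σ(s)}(oracleOf y)` is `evalBool` of a polynomial of total
  degree `≤ 2T` in the relevant bits;
* **`bbbvMag_eq_hashedAvg`** — `m_s(ρ) = 2^{-|key|} Σ_key 4T · W_{σ(s)}(oracleOf (hash_key ◁ ρ))` for `k ≥ 2T`,
  `m + 1 ≥` width; **`blockMag_eq_hashedAvg`** — the same for `M_u(ρ)` (sum over the bits of the block inside).

With `nodeMean_eq_hashedAvg` this expresses all three kinds of node quantities as averages, over a polynomial
number of key bits, of run statistics (acceptance probability / total query magnitude of one string) of `F` on the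
oracle "hash overridden along `ρ`" — the form a uniform quantum circuit with the keys on Hadamard wires and the hash
evaluated inside the circuit estimates. Sources: M. Zhandry, CRYPTO 2012, Thm. 3.1; C. H. Bennett, E. Bernstein,
G. Brassard, U. Vazirani, SIAM J. Comput. 26 (1997), Thm. 3.3; S. Aaronson, A. Ambainis, Theory Comput. 10 (2014),
proof of Thm. 23.
-/

-- D-0017: single-conjunct summit ⇒ the duplicate `QuantumAdvantage.QuantumAdvantage` is mandated.
set_option linter.dupNamespace false

noncomputable section

namespace Summit.QuantumAdvantage.QuantumAdvantage.Cruxes.TransferPB.Birth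

open Finset Literature.Computability.Cryptography Literature.Computability.Complexity
  Literature.Computability.QuantumComplexity Literature.Computability.QuantumComplexity.ClassicalSimulation
  Literature.Computability.Cryptography.ExplicitKWiseHash

namespace SimTreePB

variable (F : QCircuitFamily cliffordT) (x : List Bool)

/-- The `0/1` point of the oracle with prescribed relevant bits `b` is `b` read through the enumeration. [folklore] -/
theorem oraclePt_oracleOf (b : Fin (numOracleBits F x) → Bool) :
    oraclePt (oracleWidth F x) (oracleOf F x b) = fun q => if b (bitEquiv F x q) then (1 : ℝ) else 0 := by
  funext q
  have h := congrFun (oracleBits_oracleOf F x b) (bitEquiv F x q)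
  rw [oracleBits, Equiv.symm_apply_apply] at h
  rw [oraclePt_eq_restrictBool]
  simp only [h]

/-- **The BBBV integrand is a low-degree polynomial in the relevant bits**: there is `q` of total degree `≤ 2T`
with `evalBool q y = 4T · W_{σ(s)}(oracleOf y)` for every completion `y`. [cite: BealsEtAl2001, Lemma 4.1]
[cite: BennettBernsteinBrassardVazirani1997, Def. 3.2] -/
theorem exists_bbbvPoly (s : Fin (numOracleBits F x)) :
    ∃ q : MvPolynomial (Fin (numOracleBits F x)) ℝ, q.totalDegree ≤ 2 * (F.circ x.length).oracleQueries ∧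
      ∀ y : Fin (numOracleBits F x) → Bool, evalBool q y =
        4 * ((F.circ x.length).oracleQueries : ℝ) *
          (queryWeights (oracleOf F x y) ({bitString F x s} : Set (List Bool)) (F.circ x.length).gates
            (basisState (padInput x.get (F.ancillas x.length)))).sum := by
  obtain ⟨P, hP, h⟩ := exists_sumQueryWeightsPolynomialOn F x ({bitString F x s} : Set (List Bool))
  refine ⟨(4 * ((F.circ x.length).oracleQueries : ℝ)) • MvPolynomial.rename (bitEquiv F x) P,
    (MvPolynomial.totalDegree_smul_le _ _).trans ((MvPolynomial.totalDegree_rename_le _ _).trans hP), fun y => ?_⟩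
  rw [evalBool, MvPolynomial.smul_eval, MvPolynomial.eval_rename, h (oracleOf F x y), oraclePt_oracleOf]
  rfl

/-- **The SINGLE node quantity over the explicit hashed completion is exact**: for `k ≥ 2T` and `m + 1 ≥` the
oracle width, `m_s(ρ)` equals the average over the `6(k+m+1)²`-bit keys of `4T · W_{σ(s)}` in the run of `F` at
`x` on the oracle whose relevant bits are the hash `stdFamily k m key` overridden along `ρ`.
[cite: Zhandry2012IBE, Thm. 3.1] [cite: AaronsonAmbainis2014, Thm. 23 (proof, p. 14)] -/
theorem bbbvMag_eq_hashedAvg (k m : ℕ) (hk : 2 * (F.circ x.length).oracleQueries ≤ k)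
    (hm : oracleWidth F x ≤ m + 1) (ρ : List (Fin (numOracleBits F x) × Bool)) (s : Fin (numOracleBits F x)) :
    bbbvMag F x ρ s =
      (∑ key : Fin (keyPoly.eval (k + m)) → Bool,
        4 * ((F.circ x.length).oracleQueries : ℝ) *
          (queryWeights (oracleOf F x (ρ.foldr (fun ib z => Function.update z ib.1 ib.2)
              (oracleBits F x (stdFamily k m key)))) ({bitString F x s} : Set (List Bool))
            (F.circ x.length).gates (basisState (padInput x.get (F.ancillas x.length)))).sum) /
        2 ^ keyPoly.eval (k + m) := by
  obtain ⟨q, hq, hqy⟩ := exists_bbbvPoly F x s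
  have hdeg : (restrictPath ρ q).totalDegree ≤ k := (totalDegree_restrictPath_le ρ _).trans (hq.trans hk)
  have havg := (isKWiseIndepFamily_stdFamily k m).keyAvg_evalBool_eq_boolAvg (bitString_injective F x)
    (bitString_mem_shortStrings F x hm) (restrictPath ρ q) hdeg
  have hlhs : bbbvMag F x ρ s = boolAvg (evalBool (restrictPath ρ q)) := by
    rw [bbbvMag]
    congr 1
    funext y
    rw [evalBool_restrictPath, hqy]
    rfl
  rw [hlhs, ← havg, Fintype.card_pi, Finset.prod_const, Fintype.card_bool, Finset.card_univ, Fintype.card_fin]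
  push_cast
  congr 1
  refine Finset.sum_congr rfl fun key _ => ?_
  rw [evalBool_restrictPath, famPoint_bitString, hqy]

/-- **The BLOCK node quantity over the explicit hashed completion is exact** (sum of the SINGLE identities over the
bits whose string has prefix `u`). [cite: Zhandry2012IBE, Thm. 3.1] [cite: AaronsonAmbainis2014, Thm. 23 (proof, p. 14)] -/
theorem blockMag_eq_hashedAvg (k m : ℕ) (hk : 2 * (F.circ x.length).oracleQueries ≤ k)
    (hm : oracleWidth F x ≤ m + 1) (ρ : List (Fin (numOracleBits F x) × Bool)) (u : List Bool) :
    blockMag F x ρ u =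
      (∑ key : Fin (keyPoly.eval (k + m)) → Bool,
        ∑ s ∈ univ.filter (fun s : Fin (numOracleBits F x) => u <+: bitString F x s),
          4 * ((F.circ x.length).oracleQueries : ℝ) *
            (queryWeights (oracleOf F x (ρ.foldr (fun ib z => Function.update z ib.1 ib.2)
                (oracleBits F x (stdFamily k m key)))) ({bitString F x s} : Set (List Bool))
              (F.circ x.length).gates (basisState (padInput x.get (F.ancillas x.length)))).sum) /
        2 ^ keyPoly.eval (k + m) := by
  classical
  rw [blockMag, Finset.sum_comm, Finset.sum_div]
  refine Finset.sum_congr rfl fun s _ => ?_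
  exact bbbvMag_eq_hashedAvg F x k m hk hm ρ s

end SimTreePB

end Summit.QuantumAdvantage.QuantumAdvantage.Cruxes.TransferPB.Birth

end
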